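import Literature.Geometry.Lorentzian.CoordShrinkerCurvatureGradientBound
import HarnessLib

/-!
# Stubs `helper_mwCurvatureAlgebraFin4` and `helper_mwCurvatureGradientBound`

Crux `stmt-SmoothPoincare4-10868` (`EntropyRung.NoncompactShrinkerGap`), line
`collapsed-ends-usc`, programme "Munteanu–Wang 2015, Thm. 1.4" (a complete four-dimensional
gradient shrinking Ricci soliton with bounded scalar curvature has bounded curvature): the two
registered helper stubs carrying the pointwise algebra of Munteanu–Wang 2015, Prop. 1.1, proved by
the Literature theorems `MetricCoord.rm_sq_sum_le_fin_four` and
`MetricCoord.IsMetricOn.gradSqAt_mul_rmNormSqAt_le_of_soliton`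
(`Literature/Geometry/Lorentzian/CoordShrinkerCurvatureGradientBound.lean`).

## References

* O. Munteanu, J. Wang, *Geometry of shrinking Ricci solitons*, Compositio Math. 151 (2015)
  2273–2300 (arXiv:1410.3813), Prop. 1.1 (p. 4). [MunteanuWang2015]
-/

noncomputable section

-- `Summit.SmoothPoincare4.SmoothPoincare4.…` (summit = problem) trips `dupNamespace` on every decl.
set_option linter.dupNamespace false

open scoped ContDiff Topology
open Set Filter Module Literature.Geometry.Lorentzian

namespace Summit.SmoothPoincare4.SmoothPoincare4.Theorems.NoncompactShrinkerGapMW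

/-- **Stub `helper_mwCurvatureAlgebraFin4`** (the algebra of Munteanu–Wang 2015, Prop. 1.1 over
`Fin 4`): an array `R_{ijkl}` skew in each pair and pair-symmetric satisfies
`Σ R_{ijkl}² ≤ 16 Σ_{ik} (Σ_j R_{jikj})² + 16 Σ_{ijk} R_{ijk3}²`.
[cite: MunteanuWang2015, Prop. 1.1] -/
theorem helper_mwCurvatureAlgebraFin4 : ∀ (R : Fin 4 → Fin 4 → Fin 4 → Fin 4 → ℝ), (∀ i j k l, R i j k l = -R j i k l) → (∀ i j k l, R i j k l = -R i j l k) → (∀ i j k l, R i j k l = R k l i j) → ∑ i, ∑ j, ∑ k, ∑ l, R i j k l ^ 2 ≤ 16 * ∑ i, ∑ k, (∑ j, R j i k j) ^ 2 + 16 * ∑ i, ∑ j, ∑ k, R i j k 3 ^ 2 :=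
  MetricCoord.rm_sq_sum_le_fin_four

/-- **Stub `helper_mwCurvatureGradientBound`** (Munteanu–Wang 2015, Prop. 1.1 in a chart): for
metric components with `Ric + Hess f = ½ G` on `V`, `dim E = 4`, `G` positive definite on `V`:
`|∇Ric|²_x ≥ 0` and `|∇f|² |Rm|² ≤ 16 |∇f|² |Ric|² + 64 |∇Ric|²` at `x ∈ V`.
[cite: MunteanuWang2015, Prop. 1.1] -/
theorem helper_mwCurvatureGradientBound : ∀ {E : Type} [NormedAddCommGroup E] [NormedSpace ℝ E] [FiniteDimensional ℝ E] [CompleteSpace E] (G : E → E →L[ℝ] E →L[ℝ] ℝ) (V : Set E) (x : E) (f : E → ℝ) (b : Module.Basis (Fin 4) ℝ E), MetricCoord.IsMetricOn G V → x ∈ V → Module.finrank ℝ E = 4 → (∀ y ∈ V, ∀ v : E, v ≠ 0 → 0 < G y v v) → ContDiffOn ℝ ∞ f V → (∀ y ∈ V, ∀ v w : E, MetricCoord.ricAt G y v w + MetricCoord.hessAt G f y v w = (1 / 2 : ℝ) * G y v w) → 0 ≤ ∑ k, ∑ l, MetricCoord.ginv G b x k l * MetricCoord.pairAt G x (MetricCoord.cov₂At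 G (MetricCoord.ricAt G) x (b k)) (MetricCoord.cov₂At G (MetricCoord.ricAt G) x (b l)) ∧ MetricCoord.gradSqAt G f x * MetricCoord.rmNormSqAt G x ≤ 16 * MetricCoord.gradSqAt G f x * MetricCoord.normSqAt G x (MetricCoord.ricAt G x) + 64 * ∑ k, ∑ l, MetricCoord.ginv G b x k l * MetricCoord.pairAt G x (MetricCoord.cov₂At G (MetricCoord.ricAt G) x (b k)) (MetricCoord.cov₂At G (MetricCoord.ricAt G) x (b l)) :=
  fun _ _ x _ b hG hx hE hpos hf hsol ↦
    hG.gradSqAt_mul_rmNormSqAt_le_of_soliton b hx hE (hpos x hx) hf hsol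

end Summit.SmoothPoincare4.SmoothPoincare4.Theorems.NoncompactShrinkerGapMW

end
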